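import Literature.MathematicalPhysics.QuantumFieldTheory.ConformalBootstrap3D.MixedBlockCoefficients
import Literature.MathematicalPhysics.QuantumFieldTheory.ConformalBootstrap3D.BlockZSeries
import Mathlib.RingTheory.Polynomial.Pochhammer
import Mathlib.RingTheory.Binomial
import Mathlib.Algebra.BigOperators.NatAntidiagonal
import Mathlib.Tactic.Linarith
import Mathlib.Tactic.Positivity
import Mathlib.Tactic.Ring
import Mathlib.Tactic.FieldSimp
import HarnessLib

/-!
# Algebra of the odd-tail conversion (cell `pub-ising3x`, seat recog-1 gen 9; input to gate (g1) of M3-γ)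

HONEST FRAMING: lottery ticket; floor = tightest certified 3D Ising CFT bounds; no exact-solution
claim without a proof.

This file holds the three ELEMENTARY, calculus-free ingredients of the proposed reduction of the
mixed L-odd-tail lemma (HOME/pub-ising3x-recog-1/gen9/G1-REDUCTION.md) that are not yet in the tree:

* `stirling₂` (Stirling numbers of the second kind) and the normal-ordering identity behind the
  Euler operator `x ∂ₓ`: `Σ_{i ≤ p} S(p,i) · α(α-1)⋯(α-i+1) = α^p` for real `α`
  (`sum_stirling₂_mul_descFact`) — so a Taylor functional with weights `S(p,i) · i! · x^i` on the
  `i`-th Taylor coefficient acts on `t ↦ t^α` at `x` as `α^p x^α` (the Taylor-coefficient statements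
  on the Legendre monomials `𝒫_{E,j}` are in the companion file `OddTailEulerWeights.lean`);
* the rapidity moments `hMoment k j = Σ_{i+r=j} λ_i λ_r (i-r)^{2k}` of the Legendre array
  (`zLegendre`): non-negative, `hMoment 0 j = 1` — the diagonal values of `(x∂ₓ - y∂_y)^{2k}` on
  `𝒫_{E,j}` divided by `x^E`;
* the WEIGHTED coefficient-level AM–GM bound for the sign-indefinite Dolan–Osborn family:
  `|A_{n,j}(a,-a)| ≤ (κ A_{n,j}(a,a) + κ⁻¹ A_{n,j}(-a,-a))/2` for every `κ > 0`
  (`abs_hrCoeffAB_neg_le_weighted`; `κ = 1` is the tree's `abs_hrCoeffAB_neg_le`).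

Nothing here is specific to a certificate; no `decide`. Sources: elementary.
-/

namespace Summit.CriticalPhenomena.Ising3D

open Finset Polynomial
open Literature.MathematicalPhysics.QuantumFieldTheory.ConformalBootstrap3D

/-! ### Stirling numbers of the second kind and the Euler-operator normal ordering -/

/-- Stirling numbers of the second kind: `S(0,0) = 1`, `S(p+1,i+1) = (i+1) S(p,i+1) + S(p,i)`.
[folklore] -/
def stirling₂ : ℕ → ℕ → ℕ
  | 0, 0 => 1
  | 0, _ + 1 => 0
  | _ + 1, 0 => 0
  | p + 1, i + 1 => (i + 1) * stirling₂ p (i + 1) + stirling₂ p i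

/-- `S(0,0) = 1`. [folklore] -/
@[simp] theorem stirling₂_zero_zero : stirling₂ 0 0 = 1 := rfl

/-- `S(0,i+1) = 0`. [folklore] -/
@[simp] theorem stirling₂_zero_succ (i : ℕ) : stirling₂ 0 (i + 1) = 0 := rfl

/-- `S(p+1,0) = 0`. [folklore] -/
@[simp] theorem stirling₂_succ_zero (p : ℕ) : stirling₂ (p + 1) 0 = 0 := rfl

/-- The recursion. [folklore] -/
theorem stirling₂_succ_succ (p i : ℕ) :
    stirling₂ (p + 1) (i + 1) = (i + 1) * stirling₂ p (i + 1) + stirling₂ p i := rfl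

/-- `S(p,i) = 0` for `i > p`. [folklore] -/
theorem stirling₂_eq_zero_of_lt {p i : ℕ} (h : p < i) : stirling₂ p i = 0 := by
  induction p generalizing i with
  | zero =>
    obtain ⟨i', rfl⟩ : ∃ i', i = i' + 1 := ⟨i - 1, by omega⟩
    rfl
  | succ p ih =>
    obtain ⟨i', rfl⟩ : ∃ i', i = i' + 1 := ⟨i - 1, by omega⟩
    rw [stirling₂_succ_succ, ih (by omega), ih (by omega)]
    ring

/-- The falling factorial `α(α-1)⋯(α-i+1)` as a real number (`descPochhammer` evaluated). [folklore] -/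
noncomputable def descFact (i : ℕ) (α : ℝ) : ℝ := (descPochhammer ℝ i).eval α

/-- `descFact 0 α = 1`. [folklore] -/
@[simp] theorem descFact_zero (α : ℝ) : descFact 0 α = 1 := by
  simp [descFact]

/-- `descFact (i+1) α = descFact i α · (α - i)`. [folklore] -/
theorem descFact_succ (i : ℕ) (α : ℝ) : descFact (i + 1) α = descFact i α * (α - i) := by
  simp [descFact, descPochhammer_succ_eval]

/-- `α · descFact i α = descFact (i+1) α + i · descFact i α`. [folklore] -/
theorem mul_descFact (i : ℕ) (α : ℝ) : α * descFact i α = descFact (i + 1) α + i * descFact i α := by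
  rw [descFact_succ]
  ring

/-- **Normal ordering of the Euler operator.** For every real `α` and `p : ℕ`,
`Σ_{i ≤ p} S(p,i) · α(α-1)⋯(α-i+1) = α^p`. (Equivalently `(x∂ₓ)^p = Σ_i S(p,i) x^i ∂ₓ^i` tested on
`x^α`.) [folklore] -/
theorem sum_stirling₂_mul_descFact (p : ℕ) (α : ℝ) :
    ∑ i ∈ range (p + 1), (stirling₂ p i : ℝ) * descFact i α = α ^ p := by
  induction p with
  | zero => simp
  | succ p ih =>
    -- the shifted sum `Σ_{i<p+1} (i+1) S(p,i+1) d_{i+1}` equals `Σ_{i<p+1} i S(p,i) d_i`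
    -- (the `i = 0` term of the latter vanishes, and `S(p,p+1) = 0` kills the top term of the former)
    have h3 : ∑ i ∈ range (p + 1), ((i + 1 : ℕ) : ℝ) * (stirling₂ p (i + 1) : ℝ) * descFact (i + 1) α =
        ∑ i ∈ range (p + 1), (stirling₂ p i : ℝ) * ((i : ℝ) * descFact i α) := by
      rw [Finset.sum_range_succ, Finset.sum_range_succ' (fun i => (stirling₂ p i : ℝ) * ((i : ℝ) * descFact i α)),
        stirling₂_eq_zero_of_lt (Nat.lt_succ_self p)]
      simp only [Nat.cast_zero, mul_zero, zero_mul, add_zero]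
      refine Finset.sum_congr rfl fun i _ => ?_
      push_cast
      ring
    calc ∑ i ∈ range (p + 1 + 1), (stirling₂ (p + 1) i : ℝ) * descFact i α
        = ∑ i ∈ range (p + 1), (stirling₂ (p + 1) (i + 1) : ℝ) * descFact (i + 1) α := by
          rw [Finset.sum_range_succ' (fun i => (stirling₂ (p + 1) i : ℝ) * descFact i α)]
          simp
      _ = ∑ i ∈ range (p + 1), ((stirling₂ p i : ℝ) * descFact (i + 1) α +
            ((i + 1 : ℕ) : ℝ) * (stirling₂ p (i + 1) : ℝ) * descFact (i + 1) α) := by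
          refine Finset.sum_congr rfl fun i _ => ?_
          rw [stirling₂_succ_succ]
          push_cast
          ring
      _ = ∑ i ∈ range (p + 1), (stirling₂ p i : ℝ) * descFact (i + 1) α +
            ∑ i ∈ range (p + 1), (stirling₂ p i : ℝ) * ((i : ℝ) * descFact i α) := by
          rw [Finset.sum_add_distrib, h3]
      _ = ∑ i ∈ range (p + 1), (stirling₂ p i : ℝ) * descFact i α * α := by
          rw [← Finset.sum_add_distrib]
          refine Finset.sum_congr rfl fun i _ => ?_
          have := mul_descFact i α
          calc (stirling₂ p i : ℝ) * descFact (i + 1) α + (stirling₂ p i : ℝ) * ((i : ℝ) * descFact i α)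
              = (stirling₂ p i : ℝ) * (descFact (i + 1) α + i * descFact i α) := by ring
            _ = (stirling₂ p i : ℝ) * (α * descFact i α) := by rw [this]
            _ = (stirling₂ p i : ℝ) * descFact i α * α := by ring
      _ = α ^ p * α := by rw [← Finset.sum_mul, ih]
      _ = α ^ (p + 1) := by ring

/-- The same identity with Mathlib's generalised binomial coefficient:
`Σ_{i ≤ p} S(p,i) · i! · C(α,i) = α^p` (`descPochhammer = i! • Ring.choose`). [folklore] -/
theorem sum_stirling₂_mul_factorial_mul_choose (p : ℕ) (α : ℝ) :
    ∑ i ∈ range (p + 1), (stirling₂ p i : ℝ) * ((i.factorial : ℝ) * Ring.choose α i) = α ^ p := by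
  rw [← sum_stirling₂_mul_descFact p α]
  refine Finset.sum_congr rfl fun i _ => ?_
  have hc : Ring.choose α i = (descPochhammer ℝ i).eval α / (i.factorial : ℝ) := by
    rw [Ring.choose_eq_smul, Polynomial.descPochhammer_smeval_eq_ascPochhammer,
      Polynomial.ascPochhammer_smeval_eq_eval, ← descPochhammer_eval_eq_ascPochhammer, smul_eq_mul,
      div_eq_inv_mul]
  have hi : (i.factorial : ℝ) ≠ 0 := Nat.cast_ne_zero.mpr (Nat.factorial_ne_zero i)
  rw [hc, descFact]
  field_simp

/-! ### Rapidity moments of the Legendre array -/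

/-- `hMoment k j = Σ_{i+r=j} λ_i λ_r (i-r)^{2k}` — the value of `(x∂ₓ - y∂_y)^{2k} 𝒫_{E,j}` at a
diagonal point divided by `x^E` (`h_0 = 1`, `h_1 = j(j+1)/2`, `h_2 = (3J²-2J)/8`, `J = j(j+1)`).
[folklore] -/
noncomputable def hMoment (k j : ℕ) : ℝ :=
  ∑ c ∈ antidiagonal j, legendreLam c.1 * legendreLam c.2 * ((c.1 : ℝ) - c.2) ^ (2 * k)

/-- `hMoment k j ≥ 0`. [folklore] -/
theorem hMoment_nonneg (k j : ℕ) : 0 ≤ hMoment k j := by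
  unfold hMoment
  refine Finset.sum_nonneg fun c _ => ?_
  have h1 := legendreLam_pos c.1
  have h2 := legendreLam_pos c.2
  have h3 : 0 ≤ ((c.1 : ℝ) - c.2) ^ (2 * k) := by
    rw [pow_mul]
    positivity
  positivity

/-- `hMoment 0 j = 1` (`P_j(1) = Σ λ_i λ_{j-i} = 1`). [folklore] -/
theorem hMoment_zero (j : ℕ) : hMoment 0 j = 1 := by
  unfold hMoment
  simp only [Nat.mul_zero, pow_zero, mul_one]
  exact sum_antidiagonal_legendreLam_mul j

/-! ### Weighted AM–GM for the sign-indefinite Dolan–Osborn family -/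

/-- **Weighted coefficient-level Cauchy–Schwarz.** Strictly above the unitarity bound (and `Δ ≠ 1`
if `ℓ = 0`), for every `κ > 0`:
`|A_{n,j}(a,-a)| ≤ (κ A_{n,j}(a,a) + κ⁻¹ A_{n,j}(-a,-a))/2`. From `A(a,-a)² = A(a,a) A(-a,-a)`
(`hrCoeffAB_neg_sq`) and `(√κ y - z/√κ)² ≥ 0`; `κ = 1` is `abs_hrCoeffAB_neg_le`.
[cite: DolanOsborn2004, §3 eq. (3.11)] -/
theorem abs_hrCoeffAB_neg_le_weighted {a Δ κ : ℝ} {ℓ : ℕ} (hΔ : unitarityBound3D ℓ < Δ)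
    (h1 : ℓ = 0 → Δ ≠ 1) (hκ : 0 < κ) (n j : ℕ) :
    |hrCoeffAB a (-a) Δ ℓ n j| ≤
      (κ * hrCoeffAB a a Δ ℓ n j + κ⁻¹ * hrCoeffAB (-a) (-a) Δ ℓ n j) / 2 := by
  have hP := (doPochFactor_zero_zero_pos hΔ h1 n j).ne'
  have hsq := hrCoeffAB_neg_sq (a := a) hP
  have hp := hrCoeffAB_self_nonneg a hΔ n j
  have hm := hrCoeffAB_self_nonneg (-a) hΔ n j
  set x := hrCoeffAB a (-a) Δ ℓ n j
  set p := hrCoeffAB a a Δ ℓ n j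
  set q := hrCoeffAB (-a) (-a) Δ ℓ n j
  have hκ' : 0 < κ⁻¹ := inv_pos.mpr hκ
  have hkk : κ * κ⁻¹ = 1 := mul_inv_cancel₀ hκ.ne'
  -- (κ p + κ⁻¹ q)/2 ≥ √(p q) = |x|
  have key : x ^ 2 ≤ ((κ * p + κ⁻¹ * q) / 2) ^ 2 := by
    have : ((κ * p + κ⁻¹ * q) / 2) ^ 2 - p * q = ((κ * p - κ⁻¹ * q) / 2) ^ 2 := by
      field_simp
      ring
    nlinarith [sq_nonneg ((κ * p - κ⁻¹ * q) / 2)]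
  have hnonneg : 0 ≤ (κ * p + κ⁻¹ * q) / 2 := by positivity
  calc |x| = Real.sqrt (x ^ 2) := (Real.sqrt_sq_eq_abs x).symm
    _ ≤ Real.sqrt (((κ * p + κ⁻¹ * q) / 2) ^ 2) := Real.sqrt_le_sqrt key
    _ = (κ * p + κ⁻¹ * q) / 2 := Real.sqrt_sq hnonneg

end Summit.CriticalPhenomena.Ising3D
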